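import Mathlib
import Literature.Computability.AlgebraicComplexity.OrbitAveragingCircuitEval
import Summits.ValiantsHypothesis.ValiantsHypothesis.Theses.ProofCarryingSymmetry

/-!
# Route ProofCarryingSymmetry — crux `RestorationQP` (stmt-ValiantsHypothesis-10343), line `registered`:
the fixed-`n` instances of the stability stubs

The line's stability statements (birth stub L `stub_stabilityOfProvableSymmetry`, and after the
cycle-1 reshape the pair S2 `stub_proofsToACInvariance` / S3 `stub_stabilityAtACBudget`) ask for ONE
exponent `c` serving every `n`.  Orbit averaging (`PICircuit.exists_isSymmetric_perm_of_rename_eval_eq`,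
size `≤ n² + (2·n! + 1)|C| + 5`) and soundness of `P_c` (`HasPCProofWithin.eval_eq`, HT Prop. 1.1)
give each FIXED-`n` instance of these statements, in the all-`σ` phrasing of the registered stubs
and for ANY size/axiom budget of the invariance proofs: only the uniformity of `c` in `n` is at
stake.  (The sibling file `ProofCarryingSymmetryStabilityOfProvableSymmetryFixedN.lean` records the
same for the adjacent-transposition phrasing of item stmt-ValiantsHypothesis-10358.)

* `exists_isSymmetric_of_hasPCProofWithin_perm` — symmetric circuit of size `≤ n² + (2·n!+1)|C| + 5`
  from proofs (any budget) of all `C ∘ σ = C`;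
* `stability_allPerm_fixed_n` — `∀ n, ∃ c, ∀ C …, card ≤ (|C| + n + 2)^c` (`c = 2·n! + 6`), the
  `∀ n ∃ c` form of S3 (and, a fortiori, of L with any `t`).
-/

set_option linter.dupNamespace false

namespace Summit.ValiantsHypothesis.ValiantsHypothesis.Theorems

open MvPolynomial Literature.Computability.AlgebraicComplexity

/-- **Soundness makes `Ĉ` invariant; orbit averaging makes it symmetric.** If every invariance
identity `C ∘ σ = C`, `σ ∈ S_n`, of a Hrubeš–Tzameret circuit over `ℂ` in the matrix variables has
a `P_c`-proof (within any size and axiom budget, possibly depending on `σ`), then an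
`S_n`-symmetric labelled circuit of size `≤ n² + (2·n! + 1)|C| + 5` computes `Ĉ`. [folklore] -/
theorem exists_isSymmetric_of_hasPCProofWithin_perm {n : ℕ} (C : PICircuit ℂ (Fin n × Fin n))
    (h : ∀ σ : Equiv.Perm (Fin n), ∃ (size : ℕ∞) (budget : PIAxiom → ℕ∞),
      HasPCProofWithin (C.rename fun x : Fin n × Fin n => σ • x) C size budget) :
    ∃ (G : Type) (_ : Fintype G) (D : LabelledArithCircuit ℂ (Fin n × Fin n) Unit G),
      D.IsSymmetric (Equiv.Perm (Fin n)) ∧ D.eval (D.output ()) = C.eval ∧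
      Fintype.card G ≤ n ^ 2 + (2 * n.factorial + 1) * C.size + 5 := by
  refine C.exists_isSymmetric_perm_of_rename_eval_eq fun σ => ?_
  obtain ⟨size, budget, hσ⟩ := h σ
  have := hσ.eval_eq
  rwa [PICircuit.eval_rename] at this

/-- **The `∀ n, ∃ c` form of the stability stubs holds** (`c = 2·n! + 6`): for every FIXED `n`
there is `c` such that every circuit `C` all of whose invariance identities have `P_c(ℂ)`-proofs
(any size, any axiom budget) is computed by an `S_n`-symmetric labelled circuit of size
`≤ (|C| + n + 2)^c`.  The registered stubs S3 (`stub_stabilityAtACBudget`) and L ask for `c`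
uniform in `n`. [folklore] -/
theorem stability_allPerm_fixed_n (n : ℕ) : ∃ c : ℕ, ∀ C : PICircuit ℂ (Fin n × Fin n),
    (∀ σ : Equiv.Perm (Fin n), ∃ (size : ℕ∞) (budget : PIAxiom → ℕ∞),
      HasPCProofWithin (C.rename fun x : Fin n × Fin n => σ • x) C size budget) →
    ∃ (G : Type) (_ : Fintype G) (D : LabelledArithCircuit ℂ (Fin n × Fin n) Unit G),
      D.IsSymmetric (Equiv.Perm (Fin n)) ∧ D.eval (D.output ()) = C.eval ∧
      Fintype.card G ≤ (C.size + n + 2) ^ c := by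
  refine ⟨2 * n.factorial + 6, fun C h => ?_⟩
  obtain ⟨G, hG, D, hsym, hev, hcard⟩ := exists_isSymmetric_of_hasPCProofWithin_perm C h
  refine ⟨G, hG, D, hsym, hev, ?_⟩
  set m := C.size + n + 2 with hm
  have h1s : 1 ≤ C.size := C.one_le_size
  have hm2 : 2 ≤ m := by omega
  have hnm : n ≤ m := by omega
  have hsm : C.size ≤ m := by omega
  have hmm : m ≤ m ^ 2 := by nlinarith
  have h1 : n ^ 2 ≤ m ^ 2 := Nat.pow_le_pow_left hnm 2
  have h2 : (2 * n.factorial + 1) * C.size ≤ (2 * n.factorial + 1) * m ^ 2 :=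
    Nat.mul_le_mul_left _ (hsm.trans hmm)
  have h3 : 5 ≤ 2 * m ^ 2 := by nlinarith
  have hA : 2 * n.factorial + 4 ≤ m ^ (2 * n.factorial + 4) :=
    (Nat.lt_two_pow_self).le.trans (Nat.pow_le_pow_left hm2 _)
  calc Fintype.card G ≤ n ^ 2 + (2 * n.factorial + 1) * C.size + 5 := hcard
    _ ≤ (2 * n.factorial + 4) * m ^ 2 := by nlinarith [h1, h2, h3]
    _ ≤ m ^ (2 * n.factorial + 4) * m ^ 2 := Nat.mul_le_mul_right _ hA
    _ = m ^ (2 * n.factorial + 6) := by rw [← pow_add]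

/-- In particular the registered stub S3 (`stub_stabilityAtACBudget`: invariance provable from
A1–A5, C1, C2) holds for each fixed `n` with `c = 2·n! + 6`. [folklore] -/
theorem stabilityAtACBudget_fixed_n : ∀ n : ℕ, ∃ c : ℕ, ∀ C : PICircuit ℂ (Fin n × Fin n), (∀ σ : Equiv.Perm (Fin n), HasPCProof (C.rename fun x : Fin n × Fin n => σ • x) C (fun s => if s = PIAxiom.A6 ∨ s = PIAxiom.A7 ∨ s = PIAxiom.A8 ∨ s = PIAxiom.A9 ∨ s = PIAxiom.A10 then 0 else ⊤)) → ∃ (G : Type) (_ : Fintype G) (D : LabelledArithCircuit ℂ (Fin n × Fin n) Unit G), D.IsSymmetric (Equiv.Perm (Fin n)) ∧ D.eval (D.output ()) = C.eval ∧ Fintype.card G ≤ (C.size + n + 2) ^ c := by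
  intro n
  obtain ⟨c, hc⟩ := stability_allPerm_fixed_n n
  exact ⟨c, fun C h => hc C fun σ => ⟨⊤, _, h σ⟩⟩

/-- Likewise the birth stub L (`stub_stabilityOfProvableSymmetry`, all-`σ` phrasing, proofs of
size `≤ t`) holds for each fixed `n` with `c = 2·n! + 6`, uniformly in `t`. [folklore] -/
theorem stabilityOfProvableSymmetry_allPerm_fixed_n (n : ℕ) : ∃ c : ℕ,
    ∀ (t : ℕ) (C : PICircuit ℂ (Fin n × Fin n)),
      (∀ σ : Equiv.Perm (Fin n), HasPCProofOfSize (C.rename fun x : Fin n × Fin n => σ • x) C t) →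
      ∃ (G : Type) (_ : Fintype G) (D : LabelledArithCircuit ℂ (Fin n × Fin n) Unit G),
        D.IsSymmetric (Equiv.Perm (Fin n)) ∧ D.eval (D.output ()) = C.eval ∧
        Fintype.card G ≤ (C.size + t + n + 2) ^ c := by
  obtain ⟨c, hc⟩ := stability_allPerm_fixed_n n
  refine ⟨c, fun t C h => ?_⟩
  obtain ⟨G, hG, D, hsym, hev, hcard⟩ := hc C fun σ => ⟨(t : ℕ∞), ⊤, h σ⟩
  refine ⟨G, hG, D, hsym, hev, hcard.trans (Nat.pow_le_pow_left (by omega) _)⟩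

end Summit.ValiantsHypothesis.ValiantsHypothesis.Theorems
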